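import Summits.ABC.ABC.Theses.CubicResolventAllowance
import Literature.NumberTheory.NumberFields.CubicFieldExplicit
import Literature.NumberTheory.CubicFields.DeloneFaddeevIndexForm
import Literature.NumberTheory.CubicFields.DeloneFaddeevIrreducible
import Literature.NumberTheory.CubicFields.DeloneFaddeevCorrespondence
import Literature.NumberTheory.CubicFields.CubicFieldSignatureFromDiscriminant
import Literature.NumberTheory.EllipticCurves.SzpiroOfAbcProofs
import Literature.NumberTheory.DiophantineGeometry.MinimalDiscriminantNormProofs

/-!
# Stub ideation k=2, generation 2 (RESHAPE) — `stub_complexCubic` of crux `IndexSzpiro` (stmt-ABC-22740)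

Elaboration sanity of the NEW helper statements proposed in `STUB-IDEAS-stub_complexCubic-2.md`
(gen 2).  Statements carry `sorry` bodies (they are proposals for the stub prover); the assemblies
`stub_of_indexSquare` / `indexSquare_of_stub` and the model identity `delta_of_twoTorsion_model`
are real proofs.  Scratch namespace; nothing here is a tree proposal.  Gen-1 helpers (H0a–H2,
`SquarePartSzpiroNeg`, `stub_of_kernel`) live in `STUB_IDEAS_stub_complexCubic_2_Sketch.lean`.
-/

open Polynomial

namespace Summit.ABC.ABC.Cruxes.IndexSzpiro.StubIdeas2G2

open Literature.NumberTheory.NumberFields Literature.NumberTheory.CubicFields NumberField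

/-- The target stub, verbatim. -/
def StubComplexCubic : Prop :=
  ∀ ε : ℝ, 0 < ε → ∃ C : ℝ, ∀ (W : WeierstrassCurve ℚ) [W.IsElliptic] (K : Type) [Field K]
    [NumberField K], Irreducible W.twoTorsionPolynomial.toPoly → Module.finrank ℚ K = 3 →
    (∃ θ : K, aeval θ W.twoTorsionPolynomial.toPoly = 0) → NumberField.discr K < 0 →
    (W.minimalDiscriminantNorm ℤ : ℝ) ≤
      C * |(NumberField.discr K : ℝ)| * (W.conductorNorm ℤ : ℝ) ^ (6 + ε)

/-- Gen-1 `H1`: the sign dictionary `d_K < 0 ↔ Δ(W) < 0` on the class (restated; proof = gen-1 H0). -/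
def SignDictionary : Prop :=
  ∀ (W : WeierstrassCurve ℚ) [W.IsElliptic] (K : Type) [Field K] [NumberField K],
    Irreducible W.twoTorsionPolynomial.toPoly → Module.finrank ℚ K = 3 →
    (∃ θ : K, aeval θ W.twoTorsionPolynomial.toPoly = 0) → (NumberField.discr K < 0 ↔ W.Δ < 0)

/-- Gen-1 `H0` (unsigned half): `2⁸·Δ_min = z²·|d_K|` for some integer `z` (the index `I_E`). -/
def IndexSquareIdentity : Prop :=
  ∀ (W : WeierstrassCurve ℚ) [W.IsElliptic] (K : Type) [Field K] [NumberField K],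
    Irreducible W.twoTorsionPolynomial.toPoly → Module.finrank ℚ K = 3 →
    (∃ θ : K, aeval θ W.twoTorsionPolynomial.toPoly = 0) →
    ∃ z : ℤ, (2 : ℤ) ^ 8 * (W.minimalDiscriminantNorm ℤ : ℤ) = z ^ 2 * |NumberField.discr K|

/-! ## Technique A′ — the EXACT K-free kernel: Szpiro `6+ε` for the INDEX `I_E² = 2⁸Δ_min/|d_K|` -/

/-- **Exact kernel (open; ⟺ stub modulo `SignDictionary`/`IndexSquareIdentity`).**  For curves with
irreducible 2-division cubic and `Δ < 0`: every integer `z` with `2⁸Δ_min = z²|d_K|` (K any cubic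
field 2-dividing `W`) satisfies `z² ≤ C·N^{6+ε}`.  Gen-1's `SquarePartSzpiroNeg` implies it
(`z² ≤ 2⁸ b²` because the squarefree kernel divides `d_K`) but is stronger by the factor `|d_K|/a`. -/
def IndexSquareSzpiroNeg : Prop :=
  ∀ ε : ℝ, 0 < ε → ∃ C : ℝ, ∀ (W : WeierstrassCurve ℚ) [W.IsElliptic] (K : Type) [Field K]
    [NumberField K], Irreducible W.twoTorsionPolynomial.toPoly → Module.finrank ℚ K = 3 →
    (∃ θ : K, aeval θ W.twoTorsionPolynomial.toPoly = 0) → W.Δ < 0 →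
    ∀ z : ℤ, (2 : ℤ) ^ 8 * (W.minimalDiscriminantNorm ℤ : ℤ) = z ^ 2 * |NumberField.discr K| →
    ((z : ℝ) ^ 2 ≤ C * (W.conductorNorm ℤ : ℝ) ^ (6 + ε))

/-- Assembly (VERIFIED): exact kernel + sign dictionary + index identity ⇒ stub, with `C ↦ max C 0 / 2⁸`. -/
theorem stub_of_indexSquare (hK : IndexSquareSzpiroNeg) (h1 : SignDictionary)
    (h0 : IndexSquareIdentity) : StubComplexCubic := by
  intro ε hε
  obtain ⟨C, hC⟩ := hK ε hε
  refine ⟨max C 0 / 2 ^ 8, ?_⟩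
  intro W _ K _ _ hirr h3 hθ hdK
  have hΔ : W.Δ < 0 := (h1 W K hirr h3 hθ).mp hdK
  obtain ⟨z, hz⟩ := h0 W K hirr h3 hθ
  have hzb : (z : ℝ) ^ 2 ≤ C * (W.conductorNorm ℤ : ℝ) ^ (6 + ε) := hC W K hirr h3 hθ hΔ z hz
  have hN0 : (0 : ℝ) ≤ (W.conductorNorm ℤ : ℝ) ^ (6 + ε) := Real.rpow_nonneg (Nat.cast_nonneg _) _
  have hzb' : (z : ℝ) ^ 2 ≤ max C 0 * (W.conductorNorm ℤ : ℝ) ^ (6 + ε) :=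
    hzb.trans (mul_le_mul_of_nonneg_right (le_max_left C 0) hN0)
  have hcast : (2 : ℝ) ^ 8 * (W.minimalDiscriminantNorm ℤ : ℝ) =
      (z : ℝ) ^ 2 * |(NumberField.discr K : ℝ)| := by
    have := congrArg (fun t : ℤ => (t : ℝ)) hz
    push_cast [Int.cast_abs] at this
    linear_combination this
  have habs : (0 : ℝ) ≤ |(NumberField.discr K : ℝ)| := abs_nonneg _
  have key : (2 : ℝ) ^ 8 * (W.minimalDiscriminantNorm ℤ : ℝ) ≤
      max C 0 * |(NumberField.discr K : ℝ)| * (W.conductorNorm ℤ : ℝ) ^ (6 + ε) := by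
    rw [hcast]
    calc (z : ℝ) ^ 2 * |(NumberField.discr K : ℝ)|
        ≤ (max C 0 * (W.conductorNorm ℤ : ℝ) ^ (6 + ε)) * |(NumberField.discr K : ℝ)| :=
          mul_le_mul_of_nonneg_right hzb' habs
      _ = max C 0 * |(NumberField.discr K : ℝ)| * (W.conductorNorm ℤ : ℝ) ^ (6 + ε) := by ring
  have h256 : (0 : ℝ) < 2 ^ 8 := by positivity
  calc (W.minimalDiscriminantNorm ℤ : ℝ)
      = ((2 : ℝ) ^ 8 * (W.minimalDiscriminantNorm ℤ : ℝ)) / 2 ^ 8 := by field_simp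
    _ ≤ (max C 0 * |(NumberField.discr K : ℝ)| * (W.conductorNorm ℤ : ℝ) ^ (6 + ε)) / 2 ^ 8 :=
          div_le_div_of_nonneg_right key h256.le
    _ = max C 0 / 2 ^ 8 * |(NumberField.discr K : ℝ)| * (W.conductorNorm ℤ : ℝ) ^ (6 + ε) := by ring

/-- Converse (VERIFIED): the stub gives the exact kernel back (`C ↦ 2⁸ · max C 0`), so nothing is lost:
`IndexSquareSzpiroNeg` is the stub in K-free currency, not a strengthening. -/
theorem indexSquare_of_stub (hS : StubComplexCubic) (h1 : SignDictionary) : IndexSquareSzpiroNeg := by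
  intro ε hε
  obtain ⟨C, hC⟩ := hS ε hε
  refine ⟨2 ^ 8 * max C 0, ?_⟩
  intro W _ K _ _ hirr h3 hθ hΔ z hz
  have hdK : NumberField.discr K < 0 := (h1 W K hirr h3 hθ).mpr hΔ
  have hst := hC W K hirr h3 hθ hdK
  have hN0 : (0 : ℝ) ≤ (W.conductorNorm ℤ : ℝ) ^ (6 + ε) := Real.rpow_nonneg (Nat.cast_nonneg _) _
  have habs : (0 : ℝ) < |(NumberField.discr K : ℝ)| := by
    have : (NumberField.discr K : ℝ) ≠ 0 := by exact_mod_cast NumberField.discr_ne_zero K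
    exact abs_pos.mpr this
  have hst' : (W.minimalDiscriminantNorm ℤ : ℝ) ≤
      max C 0 * |(NumberField.discr K : ℝ)| * (W.conductorNorm ℤ : ℝ) ^ (6 + ε) :=
    hst.trans (by gcongr; exact le_max_left C 0)
  have hcast : (z : ℝ) ^ 2 * |(NumberField.discr K : ℝ)| =
      (2 : ℝ) ^ 8 * (W.minimalDiscriminantNorm ℤ : ℝ) := by
    have := congrArg (fun t : ℤ => (t : ℝ)) hz
    push_cast [Int.cast_abs] at this
    linear_combination -this
  have key : (z : ℝ) ^ 2 * |(NumberField.discr K : ℝ)| ≤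
      (2 ^ 8 * max C 0 * (W.conductorNorm ℤ : ℝ) ^ (6 + ε)) * |(NumberField.discr K : ℝ)| := by
    rw [hcast]
    calc (2 : ℝ) ^ 8 * (W.minimalDiscriminantNorm ℤ : ℝ)
        ≤ (2 : ℝ) ^ 8 * (max C 0 * |(NumberField.discr K : ℝ)| * (W.conductorNorm ℤ : ℝ) ^ (6 + ε)) :=
          mul_le_mul_of_nonneg_left hst' (by positivity)
      _ = (2 ^ 8 * max C 0 * (W.conductorNorm ℤ : ℝ) ^ (6 + ε)) * |(NumberField.discr K : ℝ)| := by
          ring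
  exact le_of_mul_le_mul_right key habs

/-! ## Technique B — change of variables `E ↦ (K, lattice point)`: the index IS a value of the
Delone–Faddeev index form of `𝓞_K`, a binary cubic form of NEGATIVE discriminant `d_K` -/

/-- **IF1 (M, sign-free).** For an integral basis `b = (1, ω, θ)` of `𝓞_K` and any `u ∈ 𝓞_K`, the
`ℚ`-discriminant of `(1, u, u²)` is `F_b(x, y)² · d_K`, `(x, y)` the `(ω, θ)`-coordinates of `u`
(tree `det_toMatrix_one_self_sq` + Mathlib `Algebra.discr_of_matrix_vecMul`, `NumberField.discr_eq_discr`). -/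
theorem IF1_discr_one_u_usq (K : Type) [Field K] [NumberField K] (b : Module.Basis (Fin 3) ℤ (𝓞 K))
    (hb : b 0 = 1) (u : 𝓞 K) :
    Algebra.discr ℚ ![(1 : K), (u : K), (u : K) ^ 2] =
      (((indexForm b).eval (b.repr u 1) (b.repr u 2) : ℤ) : ℚ) ^ 2 * (NumberField.discr K : ℚ) := by
  sorry

/-- **IF2 (M, the curve's index; b-model constant `2⁸`, cf. realCubic-2's A1b with `2⁸3¹²` for the
c-model).**  With `W₀` an integral model, `θ₀ = 4θ'` the integral root of `X³ + b₂X² + 8b₄X + 16b₆`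
(gen-1 H0b) viewed in `𝓞_K` (`MonicCubic.thetaInt`), and `(x, y)` its coordinates on `b`:
`2⁸ · Δ(W₀) = d_K · F_b(x, y)²` — so `I_E = |F_b(x, y)|` on the nose. -/
theorem IF2_curve_index (W₀ : WeierstrassCurve ℤ) (K : Type) [Field K] [NumberField K]
    (h3 : Module.finrank ℚ K = 3) (b : Module.Basis (Fin 3) ℤ (𝓞 K)) (hb : b 0 = 1) (θ₀ : K)
    (hirr : Irreducible (MonicCubic.polyQ W₀.b₂ (8 * W₀.b₄) (16 * W₀.b₆)))
    (hθ : aeval θ₀ (MonicCubic.poly W₀.b₂ (8 * W₀.b₄) (16 * W₀.b₆)) = 0) :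
    (2 : ℤ) ^ 8 * W₀.Δ = NumberField.discr K *
      ((indexForm b).eval (b.repr (MonicCubic.thetaInt hθ) 1) (b.repr (MonicCubic.thetaInt hθ) 2)) ^ 2 := by
  sorry

/-- **IF3 (S, complex-specific).** The index form of `𝓞_K` has discriminant `d_K` (tree
`discr_eq_disc_indexForm` + `NumberField.discr_eq_discr`) and is irreducible (`𝓞_K` is a domain:
`RingOfForm.isIrreducible_of_isDomain` transported along `exists_ringEquiv_indexForm`); hence for
`d_K < 0` Mathews–Davenport NEGATIVE REDUCTION applies (`BinaryCubic.exists_gl2zEquiv_negReduced`):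
one may choose the integral basis so that `F_b` is reduced (unique real root, `β ∈ 𝒟`). -/
theorem IF3_indexForm_disc_irred (K : Type) [Field K] [NumberField K] (b : Module.Basis (Fin 3) ℤ (𝓞 K))
    (hb : b 0 = 1) :
    (indexForm b).disc = NumberField.discr K ∧ (indexForm b).IsIrreducible := by
  sorry

theorem IF3'_exists_negReduced_basis (K : Type) [Field K] [NumberField K]
    (hd : NumberField.discr K < 0) (b : Module.Basis (Fin 3) ℤ (𝓞 K)) (hb : b 0 = 1) :
    ∃ g : BinaryCubic ℤ, BinaryCubic.GL2ZEquiv (indexForm b) g ∧ g.disc = NumberField.discr K ∧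
      ∃ θ u v : ℝ, 0 < v ∧ |u| ≤ 1 / 2 ∧ 1 ≤ u ^ 2 + v ^ 2 ∧
        (g.b : ℝ) = -g.a * (θ + 2 * u) ∧ (g.c : ℝ) = g.a * (2 * θ * u + (u ^ 2 + v ^ 2)) ∧
        (g.d : ℝ) = -g.a * (θ * (u ^ 2 + v ^ 2)) := by
  sorry

/-- **IF4 (S, homogeneity = twisting).** `F(px, py) = p³ F(x, y)` (tree `BinaryCubic.eval_mul_mul`):
an index-form point divisible by `p` is the point of `p·η`, i.e. the curve `y² = charpoly(pη + n)` is the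
quadratic twist by `p` of `y² = charpoly(η)` — primitivity of `(x, y)` = twist-minimality at odd `p`. -/
theorem IF4_imprimitive_scaling (F : BinaryCubic ℤ) (p x y : ℤ) :
    F.eval (p * x) (p * y) = p ^ 3 * F.eval x y := by
  simp only [BinaryCubic.eval]
  ring

/-! ## Technique C — base change `ℚ → K`: on the complex class `E/K` has EXACTLY ONE `K`-rational
2-torsion point (no `C₃` case), a `K`-rational 2-isogeny, and `Δ = 16·a₄'²·(a₂'² − 4a₄')` -/

/-- **U1 (S/M).** `d_K < 0` ⇒ `K/ℚ` is not Galois (tree `not_isGalois_of_discr_neg_cubic`) ⇒ the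
irreducible 2-division cubic has exactly one root in `K` (two roots would make `K = ℚ(θ)` its splitting
field, hence normal).  On the REAL stub this fails exactly for cyclic cubic `K` (`d_K` a square). -/
theorem U1_unique_root (W : WeierstrassCurve ℚ) (K : Type) [Field K] [NumberField K]
    (hirr : Irreducible W.twoTorsionPolynomial.toPoly) (h3 : Module.finrank ℚ K = 3)
    (hd : NumberField.discr K < 0) {θ θ' : K}
    (hθ : aeval θ W.twoTorsionPolynomial.toPoly = 0) (hθ' : aeval θ' W.twoTorsionPolynomial.toPoly = 0) :
    θ' = θ := by
  sorry

/-- **U2 (S).** A `K`-root `θ` of the 2-division cubic gives a `K`-model with the 2-torsion point at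
`(0,0)`: `a₁' = a₃' = a₆' = 0`, `u = 1` (complete the square, translate `x ↦ x + θ`), and then
`a₄' = (e₂ − e₁)(e₃ − e₁) = ψ'(θ)/4` has norm `N_{K/ℚ}(a₄') = −Δ(W)/16` — the different of `ℤ[θ₀]` in
curve clothing (Mathlib `Algebra.discr_powerBasis_eq_norm`, `WeierstrassCurve.twoTorsionPolynomial_discr`). -/
theorem U2_twoTorsion_model (W : WeierstrassCurve ℚ) [W.IsElliptic] (K : Type) [Field K] [NumberField K]
    (hirr : Irreducible W.twoTorsionPolynomial.toPoly) (h3 : Module.finrank ℚ K = 3) (θ : K)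
    (hθ : aeval θ W.twoTorsionPolynomial.toPoly = 0) :
    ∃ C : WeierstrassCurve.VariableChange K, C.u = 1 ∧ (C • W.baseChange K).a₁ = 0 ∧
      (C • W.baseChange K).a₃ = 0 ∧ (C • W.baseChange K).a₆ = 0 ∧
      Algebra.norm ℚ ((C • W.baseChange K).a₄) = -W.Δ / 16 := by
  sorry

/-- **U3 (S, VERIFIED).** In such a model `Δ = 16·a₄²·(a₂² − 4a₄)`: the `X₀(2)`-shape
`Δ = 16 β² γ` with `α² = 4β + γ` (`α = a₂`, `β = a₄`, `γ = a₂² − 4a₄ = (e₂ − e₃)²`) — the dictionary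
of the QUADRATIC crux `QuadraticIndexSzpiro` (stmt-ABC-22741), one floor up (base `K`, quadratic
extension `K(√γ) = K(√d_K) = ℚ(E[2])`). -/
theorem U3_delta_of_twoTorsion_model {F : Type} [Field F] (W' : WeierstrassCurve F)
    (h₁ : W'.a₁ = 0) (h₃ : W'.a₃ = 0) (h₆ : W'.a₆ = 0) :
    W'.Δ = 16 * W'.a₄ ^ 2 * (W'.a₂ ^ 2 - 4 * W'.a₄) := by
  simp only [WeierstrassCurve.Δ, WeierstrassCurve.b₂, WeierstrassCurve.b₄, WeierstrassCurve.b₆,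
    WeierstrassCurve.b₈, h₁, h₃, h₆]
  ring

/-- **U4 (M).** Norm-of-the-different form of the minimal discriminant: for the integral root `θ₀` of the
monic model cubic `g = X³ + b₂X² + 8b₄X + 16b₆` of an integral model `W₀`,
`N_{K/ℚ}(g'(θ₀)) = −2⁸·Δ(W₀)` (Mathlib `Algebra.discr_powerBasis_eq_norm` with `n = 3`, tree
`MonicCubic.minpoly_rat_eq` / `discr_pb`, gen-1 H0b `disc g = 2⁸Δ`). -/
theorem U4_norm_derivative (W₀ : WeierstrassCurve ℤ) (K : Type) [Field K] [NumberField K]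
    (h3 : Module.finrank ℚ K = 3) (θ₀ : K)
    (hirr : Irreducible (MonicCubic.polyQ W₀.b₂ (8 * W₀.b₄) (16 * W₀.b₆)))
    (hθ : aeval θ₀ (MonicCubic.poly W₀.b₂ (8 * W₀.b₄) (16 * W₀.b₆)) = 0) :
    Algebra.norm ℚ (aeval θ₀ (derivative (MonicCubic.polyQ W₀.b₂ (8 * W₀.b₄) (16 * W₀.b₆)))) =
      -((2 : ℚ) ^ 8 * (W₀.Δ : ℚ)) := by
  sorry

/-! ## Technique D — weaken: the allowance EXPONENT is not load-bearing for the route's `closes` -/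

/-- Allowance to the power `A` (A = 1 is the crux).  For every fixed `A`, `IndexSzpiroPow A` still pays
polynomial Szpiro `6 + 2A + ε` on the class through `ResolventDiscBounds` (`|d_K| ≤ 1944 N²`), which is all
`ResolventPayoff` consumes; a Diophantine-approximation proof run on a REDUCED index form (IF3′) would
naturally output some `A > 1` (its constants are powers of `|disc F| = |d_K|`). -/
def IndexSzpiroPow (A : ℝ) : Prop :=
  ∀ ε : ℝ, 0 < ε → ∃ C : ℝ, ∀ (W : WeierstrassCurve ℚ) [W.IsElliptic] (K : Type) [Field K]
    [NumberField K], Irreducible W.twoTorsionPolynomial.toPoly → Module.finrank ℚ K = 3 →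
    (∃ θ : K, aeval θ W.twoTorsionPolynomial.toPoly = 0) → NumberField.discr K < 0 →
    (W.minimalDiscriminantNorm ℤ : ℝ) ≤
      C * |(NumberField.discr K : ℝ)| ^ A * (W.conductorNorm ℤ : ℝ) ^ (6 + ε)

/-- `A = 1` is literally the stub. -/
example : IndexSzpiroPow 1 ↔ StubComplexCubic := by
  simp only [IndexSzpiroPow, StubComplexCubic, Real.rpow_one]

/-- **D1 (S, VERIFIED).** Monotonicity in `A` (since `|d_K| ≥ 1`): the stub implies every `IndexSzpiroPow A`, `A ≥ 1`. -/
theorem D1_pow_mono {A A' : ℝ} (hAA' : A ≤ A') (h : IndexSzpiroPow A) : IndexSzpiroPow A' := by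
  intro ε hε
  obtain ⟨C, hC⟩ := h ε hε
  refine ⟨max C 0, ?_⟩
  intro W _ K _ _ hirr h3 hθ hdK
  have h1 : (1 : ℝ) ≤ |(NumberField.discr K : ℝ)| := by
    have := Int.one_le_abs (NumberField.discr_ne_zero K)
    exact_mod_cast this
  have hN0 : (0 : ℝ) ≤ (W.conductorNorm ℤ : ℝ) ^ (6 + ε) := Real.rpow_nonneg (Nat.cast_nonneg _) _
  have hpow : |(NumberField.discr K : ℝ)| ^ A ≤ |(NumberField.discr K : ℝ)| ^ A' :=
    Real.rpow_le_rpow_of_exponent_le h1 hAA'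
  have hA0 : (0 : ℝ) ≤ |(NumberField.discr K : ℝ)| ^ A := Real.rpow_nonneg (abs_nonneg _) _
  calc (W.minimalDiscriminantNorm ℤ : ℝ)
      ≤ C * |(NumberField.discr K : ℝ)| ^ A * (W.conductorNorm ℤ : ℝ) ^ (6 + ε) :=
        hC W K hirr h3 hθ hdK
    _ ≤ max C 0 * |(NumberField.discr K : ℝ)| ^ A * (W.conductorNorm ℤ : ℝ) ^ (6 + ε) :=
        mul_le_mul_of_nonneg_right (mul_le_mul_of_nonneg_right (le_max_left C 0) hA0) hN0
    _ ≤ max C 0 * |(NumberField.discr K : ℝ)| ^ A' * (W.conductorNorm ℤ : ℝ) ^ (6 + ε) :=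
        mul_le_mul_of_nonneg_right (mul_le_mul_of_nonneg_left hpow (le_max_right C 0)) hN0

/-- **D2 (M).** Payoff with exponent `A`: `IndexSzpiroPow A` + the cubic half of `ResolventDiscBounds`
⇒ Szpiro `6 + 2A + ε` (log form, some constant) on the complex class. -/
theorem D2_payoff_pow (A : ℝ) (hA : 0 ≤ A) (h : IndexSzpiroPow A)
    (hd : ∀ (W : WeierstrassCurve ℚ) [W.IsElliptic] (K : Type) [Field K] [NumberField K],
      Irreducible W.twoTorsionPolynomial.toPoly → Module.finrank ℚ K = 3 →
      (∃ θ : K, aeval θ W.twoTorsionPolynomial.toPoly = 0) →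
      |(NumberField.discr K : ℝ)| ≤ 1944 * (W.conductorNorm ℤ : ℝ) ^ (2 : ℕ)) :
    ∀ ε : ℝ, 0 < ε → ∃ C : ℝ, ∀ (W : WeierstrassCurve ℚ) [W.IsElliptic] (K : Type) [Field K]
      [NumberField K], Irreducible W.twoTorsionPolynomial.toPoly → Module.finrank ℚ K = 3 →
      (∃ θ : K, aeval θ W.twoTorsionPolynomial.toPoly = 0) → NumberField.discr K < 0 →
      (W.minimalDiscriminantNorm ℤ : ℝ) ≤ C * (W.conductorNorm ℤ : ℝ) ^ (6 + 2 * A + ε) := by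
  sorry

/-- Sanity: `StubComplexCubic` is the registered signature up to the `Polynomial.` prefix. -/
example : StubComplexCubic ↔
    (∀ ε : ℝ, 0 < ε → ∃ C : ℝ, ∀ (W : WeierstrassCurve ℚ) [W.IsElliptic] (K : Type) [Field K]
      [NumberField K], Irreducible W.twoTorsionPolynomial.toPoly → Module.finrank ℚ K = 3 →
      (∃ θ : K, Polynomial.aeval θ W.twoTorsionPolynomial.toPoly = 0) → NumberField.discr K < 0 →
      (W.minimalDiscriminantNorm ℤ : ℝ) ≤
        C * |(NumberField.discr K : ℝ)| * (W.conductorNorm ℤ : ℝ) ^ (6 + ε)) := Iff.rfl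

end Summit.ABC.ABC.Cruxes.IndexSzpiro.StubIdeas2G2
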